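import Summits.ResolutionOfSingularities.ResolutionOfSingularities.Theorems.HomologicalConductorNoZenoExitDivisor
import Summits.ResolutionOfSingularities.ResolutionOfSingularities.Theorems.HomologicalConductorNoZenoParasite
import Literature.RingTheory.CohomologyAnnihilator.Localization
import Literature.RingTheory.CohomologyAnnihilator.Completion
import Mathlib.RingTheory.Ideal.KrullsHeightTheorem
import HarnessLib

/-!
# Crux `NoZenoR` / `NoZeno` (stmt-ResolutionOfSingularities-19943 / -16483), β layer:
# the THREAD LOCALISATION dictionary (T-SURF) for `β2 (n = 3)`

Route `ResolutionOfSingularities/HomologicalConductor`.  OURS (cell res-hironaka, chain W4.4, named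
object of planner res-L0-w44-plan-1 g12, 2026-08-27T09:02:56Z); nothing here is a statement of the
manuscript under review, and nothing here asserts a Theses declaration.

Context.  The β re-cut of idea-1 (card 5 `thread-recut`, tri-1 TRIAGE v6.0 R16) reads the kernel of
the crux in transcendence degree `3` through SINGULAR PRIME THREADS
(`…Theorems.NoZeno.SandwichCluster.Parasite.SingularPrimeThread`): compatible primes `P_m` of the
stages `T_m = tower O A m` containing the centre ideal `ca(T_m)·T_m` and different from the maximal
ideal.  `β2 (n = 3)` wants to read such a thread as a SURFACE tower of the germs
`D_m := (T_m)_{P_m}` blown up at the `𝔪`-primary ideals `I_m := ca(T_m)·D_m`.  This file is the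
dictionary every such line cites by name: for a three-dimensional normal local domain `T`,
essentially of finite type over the field `k`, and a prime `P ⊇ ca(T)` with `P ≠ 𝔪_T`, writing
`D := T_P` and `I := ca(T)·D`,

* (T1) `height P = 2`, `dim D = 2`, `D` is an integrally closed (Noetherian local) domain —
  `threadPrime_height_eq_two`, `ringKrullDim_localization_eq_two`, and `IsIntegrallyClosed D` inside
  `threadLocalisation`;  [`V(ca) = Sing` (Iyengar–Takahashi 5.4, the tree theorem
  `singEqVCa_essFiniteType_holds`) makes `T_P` singular, Serre's `R₁` for the normal `T`
  (`isRegularLocalRing_localization_of_height_le_one`) forces `height P ≥ 2`, and `P ⊊ 𝔪_T` in the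
  three-dimensional local `T` forces `height P < 3`;]
* (T2) `D` is NOT regular — `cohomologyAnnihilator_le_iff_not_isRegularLocalRing`;
* (T3) `P` is a MINIMAL prime of `ca(T)` and `I` is `𝔪_D`-primary (`√I = 𝔪_D`) —
  `mem_minimalPrimes_of_height_le_two`, `radical_map_eq_maximalIdeal_of_mem_minimalPrimes`,
  `isPrimary_map_of_mem_minimalPrimes`;
* (T4) `I ≤ ca(D)` — CITED from the tree (`map_cohomologyAnnihilator_le_of_isLocalization`,
  Iyengar–Takahashi Lemma 2.10 (1)); the equality `I = ca(D)` is NOT claimed and is false in general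
  (`Globalisation/Negative/StubCaSheafFalse.lean`, `caSheaf_false`);
* (T5) `D` is an ISOLATED singularity (`IsIsolatedSingularity D`: normal of dimension two), so that
  `ca(D)` is `𝔪_D`-primary as well — the Theorem-A-type binder of the surface lines.

`threadLocalisation` packages (T1)–(T5) for an abstract `T`; `threadLocalisation_tower` is the same
for a stage `T = tower O A (n + 1)` of the route's tower with the centre ideal in the `Parasite`
vocabulary (`caIdeal O A (n + 1) ≤ P`, see `caIdeal_le_iff`); `threadLocalisation_of_thread` takes
the hypotheses literally in the form a `Parasite.SingularPrimeThread` provides them (elements of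
`ca (tower O A (n+1))` lie in `P`; some `s` of `O`-value `< 1` lies outside `P` —
`ne_maximalIdeal_of_valuation_lt_one`).

References: S. Iyengar, R. Takahashi, IMRN 2016, Lemma 2.10 and Thm. 5.4 [`IyengarTakahashi2014`];
H. Matsumura, Commutative Ring Theory (1987), Thm. 11.2 / Thm. 11.5 (normal ⇒ `R₁`)
[`Matsumura1987`]; A. Bahlekeh, E. Hakimian, S. Salarian, R. Takahashi, JPAA 2015, Def. 2.2
[`BahlekehHakimianSalarianTakahashi2015`].
-/

noncomputable section

-- single-problem summit: the doubled namespace component `ResolutionOfSingularities` is forced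
set_option linter.dupNamespace false

namespace Summit.ResolutionOfSingularities.ResolutionOfSingularities.Theorems.NoZeno.SandwichCluster.Thread

open IsLocalRing Literature.RingTheory.CohomologyAnnihilator
open Literature.AlgebraicGeometry.Resolution
  (isRegularLocalRing_of_isIntegrallyClosed_of_ringKrullDim_le_one)

/-! ## `ℕ∞` bookkeeping -/

/-- In `ℕ∞`: `a < 2` gives `a ≤ 1`. [folklore] -/
private theorem enat_le_one_of_lt_two {a : ℕ∞} (h : a < 2) : a ≤ 1 := by
  induction a using ENat.recTopCoe with
  | top => simp at h
  | coe a =>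
    have h' : a < 2 := by exact_mod_cast h
    exact_mod_cast (show a ≤ 1 by omega)

/-- In `ℕ∞`: `2 ≤ a < 3` gives `a = 2`. [folklore] -/
private theorem enat_eq_two_of_le_of_lt {a : ℕ∞} (h2 : 2 ≤ a) (h3 : a < 3) : a = 2 := by
  induction a using ENat.recTopCoe with
  | top => simp at h3
  | coe a =>
    have h2' : 2 ≤ a := by exact_mod_cast h2
    have h3' : a < 3 := by exact_mod_cast h3
    exact_mod_cast (show a = 2 by omega)

/-! ## Pure commutative algebra: `R₁`, heights, minimal primes, localisation at a minimal prime -/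

section Algebra

variable {T : Type*} [CommRing T]

/-- **Serre's `R₁` for a normal Noetherian domain**: the localisation at a prime of height `≤ 1`
is a regular local ring (it is a normal Noetherian local domain of dimension `≤ 1`, hence a field or
a discrete valuation ring). [cite: Matsumura1987, Thm. 11.2 and Thm. 11.5 (normal ⇒ R₁)] -/
theorem isRegularLocalRing_localization_of_height_le_one [IsDomain T] [IsNoetherianRing T]
    [IsIntegrallyClosed T] (P : Ideal T) [P.IsPrime] (hP : P.height ≤ 1) :
    IsRegularLocalRing (Localization.AtPrime P) := by
  -- adapted from `SyzygyFlattening.stub_R1_of_normal` (the dimension-free part of its proof)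
  haveI : IsIntegrallyClosed (Localization.AtPrime P) :=
    isIntegrallyClosed_of_isLocalization (Localization.AtPrime P) P.primeCompl
      P.primeCompl_le_nonZeroDivisors
  refine isRegularLocalRing_of_isIntegrallyClosed_of_ringKrullDim_le_one (Localization.AtPrime P) ?_
  rw [IsLocalization.AtPrime.ringKrullDim_eq_height P (Localization.AtPrime P)]
  exact_mod_cast hP

/-- In a normal Noetherian domain, a prime with SINGULAR localisation has height `≥ 2`
(contrapositive of `R₁`). [cite: Matsumura1987, Thm. 11.5 (normal ⇒ R₁)] -/
theorem two_le_height_of_not_isRegularLocalRing [IsDomain T] [IsNoetherianRing T]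
    [IsIntegrallyClosed T] (P : Ideal T) [P.IsPrime]
    (h : ¬ IsRegularLocalRing (Localization.AtPrime P)) : 2 ≤ P.height := by
  by_contra hlt
  rw [not_le] at hlt
  exact h (isRegularLocalRing_localization_of_height_le_one P (enat_le_one_of_lt_two hlt))

/-- In a Noetherian local ring, a prime different from the maximal ideal has strictly smaller
height. [folklore] -/
theorem height_lt_height_maximalIdeal [IsNoetherianRing T] [IsLocalRing T] (P : Ideal T)
    [P.IsPrime] (hP : P ≠ maximalIdeal T) : P.height < (maximalIdeal T).height :=
  Ideal.height_strict_mono_of_isPrime_of_isPrime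
    (lt_of_le_of_ne (IsLocalRing.le_maximalIdeal Ideal.IsPrime.ne_top') hP)

/-- **(T1, height)** In a normal Noetherian local domain of Krull dimension `3`, a non-maximal prime
with singular localisation has height exactly `2`. [folklore: `R₁` and `P ⊊ 𝔪`] -/
theorem height_eq_two_of_not_isRegularLocalRing [IsDomain T] [IsNoetherianRing T] [IsLocalRing T]
    [IsIntegrallyClosed T] (hdim : ringKrullDim T = 3) (P : Ideal T) [P.IsPrime]
    (hsing : ¬ IsRegularLocalRing (Localization.AtPrime P)) (hP : P ≠ maximalIdeal T) :
    P.height = 2 := by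
  have h2 := two_le_height_of_not_isRegularLocalRing P hsing
  have hlt := height_lt_height_maximalIdeal P hP
  have hm : (maximalIdeal T).height = 3 := by
    have h := IsLocalRing.maximalIdeal_height_eq_ringKrullDim (R := T)
    rw [hdim] at h
    rwa [← WithBot.coe_inj]
  rw [hm] at hlt
  exact enat_eq_two_of_le_of_lt h2 hlt

/-- **(T1, dimension)** … hence its localisation is two-dimensional. [folklore] -/
theorem ringKrullDim_localization_eq_two [IsDomain T] [IsNoetherianRing T] [IsLocalRing T]
    [IsIntegrallyClosed T] (hdim : ringKrullDim T = 3) (P : Ideal T) [P.IsPrime]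
    (hsing : ¬ IsRegularLocalRing (Localization.AtPrime P)) (hP : P ≠ maximalIdeal T) :
    ringKrullDim (Localization.AtPrime P) = 2 := by
  rw [IsLocalization.AtPrime.ringKrullDim_eq_height P (Localization.AtPrime P),
    height_eq_two_of_not_isRegularLocalRing hdim P hsing hP]
  rfl

/-- **(T3, minimality)** In a normal Noetherian domain, let `J` be an ideal all of whose primes are
singular (`J ≤ Q ⇒ T_Q` not regular — e.g. `J = ca(T)` when `V(ca) = Sing`).  Then every prime
`P ⊇ J` of height `≤ 2` is a MINIMAL prime of `J`: a smaller prime `Q ⊇ J` would have height `≤ 1`,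
hence regular localisation by `R₁`. [folklore] -/
theorem mem_minimalPrimes_of_height_le_two [IsDomain T] [IsNoetherianRing T] [IsIntegrallyClosed T]
    {J : Ideal T}
    (hJ : ∀ (Q : Ideal T) [Q.IsPrime], J ≤ Q → ¬ IsRegularLocalRing (Localization.AtPrime Q))
    (P : Ideal T) [P.IsPrime] (hJP : J ≤ P) (hP2 : P.height ≤ 2) : P ∈ J.minimalPrimes := by
  refine ⟨⟨‹P.IsPrime›, hJP⟩, fun Q hQ hQP => ?_⟩
  obtain ⟨hQprime, hJQ⟩ := hQ
  by_contra hne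
  have hlt : Q < P := lt_of_le_of_ne hQP (fun h => hne h.ge)
  have hhQ : Q.height < P.height := Ideal.height_strict_mono_of_isPrime_of_isPrime hlt
  have hQ1 : Q.height ≤ 1 := enat_le_one_of_lt_two (lt_of_lt_of_le hhQ hP2)
  exact hJ Q hJQ (isRegularLocalRing_localization_of_height_le_one Q hQ1)

/-- **(T3, radical)** If `P` is a minimal prime of `J`, the extension `J·T_P` of `J` to the
localisation `T_P` has radical the maximal ideal: the primes of `T_P` over `J·T_P` are the `Q·T_P`
with `J ≤ Q ≤ P`, `Q` prime, and minimality leaves only `Q = P`. [folklore] -/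
theorem radical_map_eq_maximalIdeal_of_mem_minimalPrimes {J P : Ideal T} [P.IsPrime]
    (hP : P ∈ J.minimalPrimes) :
    (J.map (algebraMap T (Localization.AtPrime P))).radical =
      maximalIdeal (Localization.AtPrime P) := by
  apply le_antisymm
  · -- `J·T_P ≤ P·T_P = 𝔪`
    have h1 : J.map (algebraMap T (Localization.AtPrime P)) ≤
        maximalIdeal (Localization.AtPrime P) := by
      rw [← Localization.AtPrime.map_eq_maximalIdeal]
      exact Ideal.map_mono hP.1.2
    calc (J.map (algebraMap T (Localization.AtPrime P))).radical
        ≤ (maximalIdeal (Localization.AtPrime P)).radical := Ideal.radical_mono h1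
      _ = maximalIdeal (Localization.AtPrime P) := Ideal.IsPrime.radical inferInstance
  · -- every prime `𝔔 ⊇ J·T_P` pulls back to a prime `Q` with `J ≤ Q ≤ P`, so `Q = P` and `𝔔 ⊇ 𝔪`
    rw [Ideal.radical_eq_sInf]
    refine le_sInf fun 𝔔 h𝔔 => ?_
    obtain ⟨hJ𝔔, h𝔔prime⟩ := h𝔔
    have hJQ : J ≤ 𝔔.comap (algebraMap T (Localization.AtPrime P)) :=
      Ideal.map_le_iff_le_comap.mp hJ𝔔
    have hQP : 𝔔.comap (algebraMap T (Localization.AtPrime P)) ≤ P := by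
      intro x hx
      by_contra hxP
      have hu : IsUnit (algebraMap T (Localization.AtPrime P) x) :=
        IsLocalization.map_units (M := P.primeCompl) (Localization.AtPrime P)
          ⟨x, show x ∈ P.primeCompl from hxP⟩
      exact h𝔔prime.ne_top (Ideal.eq_top_of_isUnit_mem _ (Ideal.mem_comap.mp hx) hu)
    have hPQ : P ≤ 𝔔.comap (algebraMap T (Localization.AtPrime P)) :=
      hP.2 ⟨Ideal.comap_isPrime _ 𝔔, hJQ⟩ hQP
    calc maximalIdeal (Localization.AtPrime P)
        = P.map (algebraMap T (Localization.AtPrime P)) :=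
          Localization.AtPrime.map_eq_maximalIdeal.symm
      _ ≤ (𝔔.comap (algebraMap T (Localization.AtPrime P))).map
            (algebraMap T (Localization.AtPrime P)) := Ideal.map_mono hPQ
      _ ≤ 𝔔 := Ideal.map_comap_le

/-- **(T3, primary)** … hence `J·T_P` is `𝔪`-primary. [folklore] -/
theorem isPrimary_map_of_mem_minimalPrimes {J P : Ideal T} [P.IsPrime]
    (hP : P ∈ J.minimalPrimes) :
    (J.map (algebraMap T (Localization.AtPrime P))).IsPrimary :=
  Ideal.isPrimary_of_isMaximal_radical
    (by rw [radical_map_eq_maximalIdeal_of_mem_minimalPrimes hP]; exact maximalIdeal.isMaximal _)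

end Algebra

/-! ## `V(ca) = Sing` for rings essentially of finite type over a field (Iyengar–Takahashi 5.4) -/

section EssFiniteType

/-- **(T2)** `ca(T) ≤ P ↔ T_P` is not regular, for every prime `P` of a domain `T` essentially of
finite type over a field `k`: Iyengar–Takahashi's Theorem 5.4, a THEOREM of the tree
(`singEqVCa_essFiniteType_holds`), applied with `T` a localisation of the finitely generated
`k`-algebra `Algebra.EssFiniteType.subalgebra k T`. [cite: IyengarTakahashi2014, Thm. 5.4] -/
theorem cohomologyAnnihilator_le_iff_not_isRegularLocalRing (k : Type) [Field k] (T : Type)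
    [CommRing T] [IsDomain T] [Algebra k T] [Algebra.EssFiniteType k T] (P : Ideal T) [P.IsPrime] :
    cohomologyAnnihilator T ≤ P ↔ ¬ IsRegularLocalRing (Localization.AtPrime P) := by
  -- adapted from `SandwichCluster.ca_le_iff_not_isRegularLocalRing_atPrime` (stage version)
  obtain ⟨d, hd, -⟩ := Literature.AlgebraicGeometry.Resolution.exists_ringKrullDim_eq_and_trdeg_eq k
    ↥(Algebra.EssFiniteType.subalgebra k T)
  have h := (singEqVCa_essFiniteType_holds.{0} k ↥(Algebra.EssFiniteType.subalgebra k T)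
    inferInstance d hd (Algebra.EssFiniteType.submonoid k T) T inferInstance P).1
  rwa [ca_eq_cohomologyAnnihilator] at h

/-- **(T3)** For `T` a normal domain essentially of finite type over a field, every prime
`P ⊇ ca(T)` of height `≤ 2` is a minimal prime of `ca(T)`. [cite: IyengarTakahashi2014, Thm. 5.4]
[folklore: `R₁`] -/
theorem mem_minimalPrimes_cohomologyAnnihilator (k : Type) [Field k] (T : Type) [CommRing T]
    [IsDomain T] [Algebra k T] [Algebra.EssFiniteType k T] [IsIntegrallyClosed T]
    (P : Ideal T) [P.IsPrime]
    (hca : cohomologyAnnihilator T ≤ P) (hP2 : P.height ≤ 2) :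
    P ∈ (cohomologyAnnihilator T).minimalPrimes := by
  haveI : IsNoetherianRing T := Algebra.EssFiniteType.isNoetherianRing k T
  exact mem_minimalPrimes_of_height_le_two
    (fun Q _ hQ => (cohomologyAnnihilator_le_iff_not_isRegularLocalRing k T Q).mp hQ) P hca hP2

/-- **THREAD LOCALISATION (T-SURF dictionary, abstract form).**  Let `T` be a normal local domain,
essentially of finite type over the field `k`, of Krull dimension `3`, and `P` a prime ideal with
`ca(T) ≤ P` and `P ≠ 𝔪_T`; put `D := T_P` and `I := ca(T)·D`.  Then: (T1) `height P = 2`,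
`dim D = 2` and `D` is integrally closed; (T2) `D` is not regular; (T3) `P` is a minimal prime of
`ca(T)`, `√I = 𝔪_D` and `I` is `𝔪_D`-primary; (T4) `I ≤ ca(D)` (Lemma 2.10 (1), cited); (T5) `D` is
an isolated singularity.  [this work; cites IyengarTakahashi2014 Thm. 5.4 / Lemma 2.10 (1),
Matsumura1987 Thm. 11.5] -/
theorem threadLocalisation (k : Type) [Field k] (T : Type) [CommRing T] [IsDomain T]
    [Algebra k T] [Algebra.EssFiniteType k T] [IsLocalRing T] [IsIntegrallyClosed T]
    (hdim : ringKrullDim T = 3)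
    (P : Ideal T) [P.IsPrime] (hca : cohomologyAnnihilator T ≤ P) (hP : P ≠ maximalIdeal T) :
    P.height = 2 ∧ ringKrullDim (Localization.AtPrime P) = 2 ∧
      IsIntegrallyClosed (Localization.AtPrime P) ∧
      ¬ IsRegularLocalRing (Localization.AtPrime P) ∧
      P ∈ (cohomologyAnnihilator T).minimalPrimes ∧
      ((cohomologyAnnihilator T).map (algebraMap T (Localization.AtPrime P))).radical =
        maximalIdeal (Localization.AtPrime P) ∧
      ((cohomologyAnnihilator T).map (algebraMap T (Localization.AtPrime P))).IsPrimary ∧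
      (cohomologyAnnihilator T).map (algebraMap T (Localization.AtPrime P)) ≤
        cohomologyAnnihilator (Localization.AtPrime P) ∧
      IsIsolatedSingularity (Localization.AtPrime P) := by
  haveI : IsNoetherianRing T := Algebra.EssFiniteType.isNoetherianRing k T
  have hsing : ¬ IsRegularLocalRing (Localization.AtPrime P) :=
    (cohomologyAnnihilator_le_iff_not_isRegularLocalRing k T P).mp hca
  have hht : P.height = 2 := height_eq_two_of_not_isRegularLocalRing hdim P hsing hP
  have hdimD : ringKrullDim (Localization.AtPrime P) = 2 :=
    ringKrullDim_localization_eq_two hdim P hsing hP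
  haveI hIC : IsIntegrallyClosed (Localization.AtPrime P) :=
    isIntegrallyClosed_of_isLocalization (Localization.AtPrime P) P.primeCompl
      P.primeCompl_le_nonZeroDivisors
  have hmin : P ∈ (cohomologyAnnihilator T).minimalPrimes :=
    mem_minimalPrimes_cohomologyAnnihilator k T P hca hht.le
  exact ⟨hht, hdimD, hIC, hsing, hmin, radical_map_eq_maximalIdeal_of_mem_minimalPrimes hmin,
    isPrimary_map_of_mem_minimalPrimes hmin,
    map_cohomologyAnnihilator_le_of_isLocalization P.primeCompl (Localization.AtPrime P),
    isIsolatedSingularity_of_isIntegrallyClosed_of_ringKrullDim_le_two hdimD.le⟩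

end EssFiniteType

/-! ## The stage version (route tower, `Parasite` vocabulary) -/

section Tower

open Summit.ResolutionOfSingularities.ResolutionOfSingularities.Theses.HomologicalConductor
open Summit.ResolutionOfSingularities.ResolutionOfSingularities.Theorems.NoZeno.Birth

variable {k K : Type} [Field k] [Field K] [Algebra k K]

/-- The centre ideal `ca(T_m)·T_m` of a stage in the `Parasite` vocabulary (`caIdeal`, the span of
the elements of `T_m` lying in the route's `ca (tower O A m) ⊆ K`) is contained in a prime `P` iff
the cohomology annihilator ideal of the ring `T_m` is. [this work] -/
theorem caIdeal_le_iff (O : ValuationSubring K) (A : Subalgebra k K) (m : ℕ)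
    (P : Ideal ↥(tower O A m)) :
    Parasite.caIdeal O A m ≤ P ↔ cohomologyAnnihilator ↥(tower O A m) ≤ P := by
  constructor
  · intro h x hx
    exact h (Ideal.subset_span ((tn_coe_mem_ca_iff (tower O A m) x).mpr hx))
  · intro h
    refine Ideal.span_le.mpr fun c hc => ?_
    exact h ((tn_coe_mem_ca_iff (tower O A m) c).mp hc)

/-- **THREAD LOCALISATION at a normalised stage `T = T_(n+1)` of the tower** (the consumer form for
`β2 (n = 3)`): if `dim T_(n+1) = 3` and `P` is a non-maximal prime of `T_(n+1)` containing the
centre ideal `caIdeal O A (n + 1)`, then with `D := (T_(n+1))_P`, `I := ca(T_(n+1))·D`: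
`height P = 2`, `dim D = 2`, `D` integrally closed and not regular, `P` minimal over `ca`,
`√I = 𝔪_D`, `I` primary, `I ≤ ca(D)`, and `D` an isolated singularity.  (`T_(n+1)` is a normal
Noetherian local domain essentially of finite type over `k`: `d2rc_isIntegrallyClosed_tower_succ`,
`tn_tower_invariant`.) [this work] -/
theorem threadLocalisation_tower (O : ValuationSubring K) (A : Subalgebra k K)
    (hk : ∀ c : k, algebraMap k K c ∈ O) (hA : A.FG) (hfr : IsFractionRing ↥A K)
    (hAO : A.toSubring ≤ O.toSubring) (n : ℕ) [IsLocalRing ↥(tower O A (n + 1))]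
    (hdim : ringKrullDim ↥(tower O A (n + 1)) = 3)
    (P : Ideal ↥(tower O A (n + 1))) [P.IsPrime] (hca : Parasite.caIdeal O A (n + 1) ≤ P)
    (hP : P ≠ maximalIdeal ↥(tower O A (n + 1))) :
    P.height = 2 ∧ ringKrullDim (Localization.AtPrime P) = 2 ∧
      IsIntegrallyClosed (Localization.AtPrime P) ∧
      ¬ IsRegularLocalRing (Localization.AtPrime P) ∧
      P ∈ (cohomologyAnnihilator ↥(tower O A (n + 1))).minimalPrimes ∧
      ((cohomologyAnnihilator ↥(tower O A (n + 1))).map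
          (algebraMap _ (Localization.AtPrime P))).radical = maximalIdeal (Localization.AtPrime P) ∧
      ((cohomologyAnnihilator ↥(tower O A (n + 1))).map
          (algebraMap _ (Localization.AtPrime P))).IsPrimary ∧
      (cohomologyAnnihilator ↥(tower O A (n + 1))).map (algebraMap _ (Localization.AtPrime P)) ≤
        cohomologyAnnihilator (Localization.AtPrime P) ∧
      IsIsolatedSingularity (Localization.AtPrime P) := by
  haveI := hfr
  haveI : IsIntegrallyClosed ↥(tower O A (n + 1)) :=
    d2rc_isIntegrallyClosed_tower_succ O A hk hA hfr hAO n
  obtain ⟨-, -, hET⟩ := tn_tower_invariant O A hk hA hfr hAO (n + 1)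
  haveI := hET
  exact threadLocalisation k ↥(tower O A (n + 1)) hdim P ((caIdeal_le_iff O A (n + 1) P).mp hca) hP

/-- In an `O`-dominated stage `T_m`, an element of `O`-value `< 1` is a non-unit, hence lies in the
maximal ideal; so a prime avoiding such an element is not the maximal ideal (the form in which
`Parasite.SingularPrimeThread` records non-maximality). [this work] -/
theorem ne_maximalIdeal_of_valuation_lt_one (O : ValuationSubring K) (A : Subalgebra k K)
    (hk : ∀ c : k, algebraMap k K c ∈ O) (hAO : A.toSubring ≤ O.toSubring) (m : ℕ)
    [IsLocalRing ↥(tower O A m)] (P : Ideal ↥(tower O A m)) {s : K} (hsT : s ∈ tower O A m)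
    (hvs : O.valuation s < 1) (hsP : (⟨s, hsT⟩ : ↥(tower O A m)) ∉ P) :
    P ≠ maximalIdeal ↥(tower O A m) := by
  intro heq
  apply hsP
  rw [heq]
  refine (IsLocalRing.mem_maximalIdeal _).mpr (mem_nonunits_iff.mpr fun hu => ?_)
  -- a unit of `T_m` is a unit of `O`, hence has value `1`
  have hsinv : s⁻¹ ∈ tower O A m := inv_mem_of_isUnit hu
  have hsO : s ∈ O := (valuationSubring_dominates_tower O A hk hAO m s hsT).1
  have hsinvO : s⁻¹ ∈ O := (valuationSubring_dominates_tower O A hk hAO m s⁻¹ hsinv).1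
  have hs0 : s ≠ 0 := fun h => by
    apply hu.ne_zero
    exact Subtype.ext h
  have huO : IsUnit (⟨s, hsO⟩ : ↥O) :=
    IsUnit.of_mul_eq_one ⟨s⁻¹, hsinvO⟩ (Subtype.ext (by simp [mul_inv_cancel₀ hs0]))
  have h1 : O.valuation s = 1 := (ValuationSubring.valuation_eq_one_iff O ⟨s, hsO⟩).mp huO
  exact absurd h1 (ne_of_lt hvs)

/-- **THREAD LOCALISATION, thread form** — the hypotheses exactly as a singular prime thread
(`Parasite.SingularPrimeThread`) provides them at a normalised stage `T = T_(n+1)` of Krull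
dimension `3`: `P` a prime of `T` containing every element of `T` lying in `ca (tower O A (n+1))`,
and some `s ∈ T` of `O`-value `< 1` outside `P`.  Conclusions (T1)–(T5) as in
`threadLocalisation` for `D := T_P`, `I := ca(T)·D`.  (`T` is local: `exists_tower_eq_loc`,
`isLocalRing_locAt`.) [this work] -/
theorem threadLocalisation_of_thread (O : ValuationSubring K) (A : Subalgebra k K)
    (hk : ∀ c : k, algebraMap k K c ∈ O) (hA : A.FG) (hfr : IsFractionRing ↥A K)
    (hAO : A.toSubring ≤ O.toSubring) (n : ℕ) (hdim : ringKrullDim ↥(tower O A (n + 1)) = 3)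
    (P : Ideal ↥(tower O A (n + 1))) [P.IsPrime]
    (hca : ∀ (x : K) (hx : x ∈ tower O A (n + 1)), x ∈ Birth.ca (tower O A (n + 1)) →
      (⟨x, hx⟩ : ↥(tower O A (n + 1))) ∈ P)
    (hs : ∃ (s : K) (hs : s ∈ tower O A (n + 1)), O.valuation s < 1 ∧
      (⟨s, hs⟩ : ↥(tower O A (n + 1))) ∉ P) :
    P.height = 2 ∧ ringKrullDim (Localization.AtPrime P) = 2 ∧
      IsIntegrallyClosed (Localization.AtPrime P) ∧
      ¬ IsRegularLocalRing (Localization.AtPrime P) ∧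
      P ∈ (cohomologyAnnihilator ↥(tower O A (n + 1))).minimalPrimes ∧
      ((cohomologyAnnihilator ↥(tower O A (n + 1))).map
          (algebraMap _ (Localization.AtPrime P))).radical = maximalIdeal (Localization.AtPrime P) ∧
      ((cohomologyAnnihilator ↥(tower O A (n + 1))).map
          (algebraMap _ (Localization.AtPrime P))).IsPrimary ∧
      (cohomologyAnnihilator ↥(tower O A (n + 1))).map (algebraMap _ (Localization.AtPrime P)) ≤
        cohomologyAnnihilator (Localization.AtPrime P) ∧
      IsIsolatedSingularity (Localization.AtPrime P) := by
  haveI : IsLocalRing ↥(tower O A (n + 1)) := by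
    obtain ⟨B, hBO, hTB⟩ := exists_tower_eq_loc O A hk hAO (n + 1)
    rw [hTB, loc_eq_locAt]
    exact SyzygyFlattening.isLocalRing_locAt O B hBO
  obtain ⟨s, hsT, hvs, hsP⟩ := hs
  have hP : P ≠ maximalIdeal ↥(tower O A (n + 1)) :=
    ne_maximalIdeal_of_valuation_lt_one O A hk hAO (n + 1) P hsT hvs hsP
  have hca' : Parasite.caIdeal O A (n + 1) ≤ P :=
    Ideal.span_le.mpr fun c hc => by simpa using hca c c.2 hc
  exact threadLocalisation_tower O A hk hA hfr hAO n hdim P hca' hP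

end Tower

end Summit.ResolutionOfSingularities.ResolutionOfSingularities.Theorems.NoZeno.SandwichCluster.Thread

end
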